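import Summits.QuantumFields.YangMills.Theorems.DirichletWindowXiDivergesLogWindow
import Summits.QuantumFields.YangMills.Theorems.DirichletWindowAxialLogConvexityLimit

/-!
# `XiDiverges` (item stmt-QuantumFields-8941): its inputs may be verified on tori

(Build note 2026-08-20, buildfix ops lane: re-landed unchanged to enqueue a lake build after its import chain
`DirichletWindowXiDiverges` was re-pointed from the dead route file `Theses/XiCompleteMonotonicity` to
`Theorems/XiCompleteMonotonicityRecords`; no declaration changed.)

Support file for the statement item stmt-QuantumFields-8941,
`Summit.QuantumFields.YangMills.Theses.DirichletWindow.XiDiverges`, continuing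
`DirichletWindowXiDiverges.lean` / `DirichletWindowXiDivergesLogWindow.lean`. Every door to
`XiDiverges` recorded there asks for a weak-coupling bound on the axial plaquette two-point
function `f_μ(n e₀) = plaquetteCorrFn r.ρ μ (n e₀)` of EVERY infinite-volume torus-limit state
`μ ∈ infiniteVolumeLimitPoints r.ρ β`. Such states are, by definition, limits of the Wilson
states of the tori `(ℤ/(L_k+1)ℤ)⁴` along some subsequence, on bounded continuous cylinder
observables; the sibling file `DirichletWindowAxialLogConvexityLimit` (item 8940) proves that the
torus axial covariances `Cov_{β,L_k+1}(Re tr r(U_{p₀}), Re tr r(U_{p₀ + n e₀}))` converge to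
`f_μ(n e₀)` (`AxialLogConvexity.tendsto_tcov`). Hence bounds that hold on ALL sufficiently large
tori pass to every limit state, and the weak-coupling provers never need to leave the torus:

* `le_plaquetteCorrFn_of_forall_torus`, `plaquetteCorrFn_le_of_forall_torus` — lower / upper
  bounds valid on every torus `(ℤ/(M+1)ℤ)⁴`, `M ≥ M₀`, hold for every limit state at the same `β`;
* `fixedDistanceLower_of_torus`, `plaquetteVarianceUpper_of_torus`, `polynomialWindow_of_torus` —
  the two conjuncts of this route's target (items 8938, 8939) and route `XiCompleteMonotonicity`'s
  crux 8937 follow from their torus versions (volume threshold allowed to depend on `β` and `n`);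
* `logWindow_of_torusLogWindow`, `xiDiverges_of_torusLogWindow` — the logarithmic window of
  `xiDiverges_of_logWindow` (`DirichletWindowXiDivergesLogWindow.lean`) verified on tori
  (separation chosen from `β` alone), and the resulting door
  `AxialLogConvexity → (torus log window) → XiDiverges`: the form in which a weak-coupling
  expansion on finite tori closes item 8941 — a lower bound `A/(β^p n^k)` (any fixed powers) for
  the axial plaquette covariance at ONE separation `n = n(β) ≥ C log β`, for every `C`, on all
  tori of side `≥ M₀(β) + 1`.

No definition is introduced; the torus plaquette observable is the tree's
`WilsonRP.plaqRe ρ U (x, q)` in the temporal plane `q = (0,1)` at the axial sites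
`x = Pi.single 0 c`, under Wilson's measure `wilsonMeasure ρ β` — the vocabulary of
`DirichletWindowAxialLogConvexityTorus`.

References: E. Seiler, LNP 159 (1982) Ch. 2 (thermodynamic limit along tori by compactness);
S. Chatterjee, arXiv:1803.01950, §2 and Problem 5.1.
(buildfix 2026-08-20: comment-only re-land to re-enqueue the module build after its blocking imports were repaired; no declaration changed.)
-/

noncomputable section

open MeasureTheory ProbabilityTheory Filter Topology
open Literature.MathematicalPhysics.QuantumFieldTheory Literature.MathematicalPhysics.QuantumLattice

namespace Summit.QuantumFields.YangMills.Theorems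

section Passage

variable {G : Type*} [Group G] [TopologicalSpace G] [IsTopologicalGroup G] [CompactSpace G]
  [MeasurableSpace G] [BorelSpace G] {N : ℕ} (ρ : G →* Matrix (Fin N) (Fin N) ℂ)

/-- **Torus lower bounds pass to limit states.** If `b ≤ Cov_{β,M+1}(P_0, P_{n e₀})` on every
torus `(ℤ/(M+1)ℤ)⁴` with `M ≥ M₀` (axial `(0,1)`-plaquettes, Wilson measure), then
`b ≤ f_μ(n e₀)` for every `μ ∈ infiniteVolumeLimitPoints ρ β` (the defining tori of `μ` are
eventually that large, and the torus covariances converge to `f_μ(n e₀)`,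
`AxialLogConvexity.tendsto_tcov`). [folklore] -/
theorem le_plaquetteCorrFn_of_forall_torus (hρ : Continuous ρ) {β : ℝ} {μ : Measure (LGConfig 4 G)}
    (hμ : μ ∈ infiniteVolumeLimitPoints (d := 4) ρ β) {n M₀ : ℕ} {b : ℝ}
    (h : ∀ M : ℕ, M₀ ≤ M → b ≤
      cov[fun U => WilsonRP.plaqRe ρ U ((Pi.single 0 0 : Site 4 (M + 1)), ⟨(0, 1), Fin.zero_lt_one⟩),
        fun U => WilsonRP.plaqRe ρ U
          ((Pi.single 0 ((n : ℕ) : ZMod (M + 1)) : Site 4 (M + 1)), ⟨(0, 1), Fin.zero_lt_one⟩);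
        wilsonMeasure (d := 4) (L := M + 1) ρ β]) :
    b ≤ plaquetteCorrFn ρ μ ((n : ℤ) • Pi.single (0 : Fin 4) (1 : ℤ)) := by
  obtain ⟨L, hL, hlim⟩ := hμ
  exact ge_of_tendsto (AxialLogConvexity.tendsto_tcov ρ hρ hlim n)
    (eventually_atTop.2 ⟨M₀, fun j hj => h (L j) (hj.trans hL.le_apply)⟩)

/-- **Torus upper bounds pass to limit states.** If `Cov_{β,M+1}(P_0, P_{n e₀}) ≤ b` on every torus
`(ℤ/(M+1)ℤ)⁴` with `M ≥ M₀`, then `f_μ(n e₀) ≤ b` for every `μ ∈ infiniteVolumeLimitPoints ρ β`.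
[folklore] -/
theorem plaquetteCorrFn_le_of_forall_torus (hρ : Continuous ρ) {β : ℝ} {μ : Measure (LGConfig 4 G)}
    (hμ : μ ∈ infiniteVolumeLimitPoints (d := 4) ρ β) {n M₀ : ℕ} {b : ℝ}
    (h : ∀ M : ℕ, M₀ ≤ M →
      cov[fun U => WilsonRP.plaqRe ρ U ((Pi.single 0 0 : Site 4 (M + 1)), ⟨(0, 1), Fin.zero_lt_one⟩),
        fun U => WilsonRP.plaqRe ρ U
          ((Pi.single 0 ((n : ℕ) : ZMod (M + 1)) : Site 4 (M + 1)), ⟨(0, 1), Fin.zero_lt_one⟩);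
        wilsonMeasure (d := 4) (L := M + 1) ρ β] ≤ b) :
    plaquetteCorrFn ρ μ ((n : ℤ) • Pi.single (0 : Fin 4) (1 : ℤ)) ≤ b := by
  obtain ⟨L, hL, hlim⟩ := hμ
  exact le_of_tendsto (AxialLogConvexity.tendsto_tcov ρ hρ hlim n)
    (eventually_atTop.2 ⟨M₀, fun j hj => h (L j) (hj.trans hL.le_apply)⟩)

/-- The torus variance of the axial plaquette is its self-covariance at separation `0`
(`Pi.single 0 ((0 : ℕ) : ZMod (M+1)) = Pi.single 0 0`). [folklore] -/
theorem variance_tplaq_eq_cov (hρ : Continuous ρ) (β : ℝ) (M : ℕ) :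
    Var[fun U => WilsonRP.plaqRe ρ U ((Pi.single 0 0 : Site 4 (M + 1)), ⟨(0, 1), Fin.zero_lt_one⟩);
        wilsonMeasure (d := 4) (L := M + 1) ρ β] =
      cov[fun U => WilsonRP.plaqRe ρ U ((Pi.single 0 0 : Site 4 (M + 1)), ⟨(0, 1), Fin.zero_lt_one⟩),
        fun U => WilsonRP.plaqRe ρ U
          ((Pi.single 0 (((0 : ℕ) : ℕ) : ZMod (M + 1)) : Site 4 (M + 1)), ⟨(0, 1), Fin.zero_lt_one⟩);
        wilsonMeasure (d := 4) (L := M + 1) ρ β] := by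
  rw [Nat.cast_zero]
  exact (covariance_self (AxialLogConvexity.measurable_tplaq
    (q := ⟨(0, 1), Fin.zero_lt_one⟩) ρ hρ _).aemeasurable).symm

end Passage

/-- **`FixedDistanceLower` may be verified on tori** (item 8938, first conjunct of this route's
target): if `A/(β² n⁸) ≤ Cov_{β,M+1}(P_0, P_{n e₀})` for `n ≥ n₀`, `β ≥ β_n` and all tori with
`M ≥ M₀(β, n)`, then `FixedDistanceLower`. [folklore] -/
theorem fixedDistanceLower_of_torus
    (hT : ∀ (G : Type) [Group G] [TopologicalSpace G] [IsTopologicalGroup G] [CompactSpace G]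
      [MeasurableSpace G] [BorelSpace G], IsCompactSimpleLieGroup G → ∀ r : LatticeRep G,
      ∃ A : ℝ, ∃ n₀ : ℕ, 0 < A ∧ ∀ n : ℕ, n₀ ≤ n → ∃ β₁ : ℝ, ∀ β : ℝ, β₁ ≤ β →
        ∃ M₀ : ℕ, ∀ M : ℕ, M₀ ≤ M →
          A / (β ^ 2 * (n : ℝ) ^ 8) ≤
            cov[fun U => WilsonRP.plaqRe r.ρ U
                ((Pi.single 0 0 : Site 4 (M + 1)), ⟨(0, 1), Fin.zero_lt_one⟩),
              fun U => WilsonRP.plaqRe r.ρ U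
                ((Pi.single 0 ((n : ℕ) : ZMod (M + 1)) : Site 4 (M + 1)), ⟨(0, 1), Fin.zero_lt_one⟩);
              wilsonMeasure (d := 4) (L := M + 1) r.ρ β]) :
    Theses.DirichletWindow.FixedDistanceLower := by
  intro G _ _ _ _ _ _ hG r
  obtain ⟨A, n₀, hA, h⟩ := hT G hG r
  refine ⟨A, n₀, hA, fun n hn => ?_⟩
  obtain ⟨β₁, hβ₁⟩ := h n hn
  refine ⟨β₁, fun β hβ μ hμ => ?_⟩
  obtain ⟨M₀, hM⟩ := hβ₁ β hβ
  exact le_plaquetteCorrFn_of_forall_torus r.ρ r.continuous hμ hM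

/-- **`PlaquetteVarianceUpper` may be verified on tori** (item 8939, second conjunct of this
route's target): if `Var_{β,M+1}(Re tr r(U_{p₀})) ≤ B/β²` for `β ≥ β₁` and all tori with
`M ≥ M₀(β)`, then `PlaquetteVarianceUpper`. [folklore] -/
theorem plaquetteVarianceUpper_of_torus
    (hT : ∀ (G : Type) [Group G] [TopologicalSpace G] [IsTopologicalGroup G] [CompactSpace G]
      [MeasurableSpace G] [BorelSpace G], IsCompactSimpleLieGroup G → ∀ r : LatticeRep G,
      ∃ B β₁ : ℝ, ∀ β : ℝ, β₁ ≤ β → ∃ M₀ : ℕ, ∀ M : ℕ, M₀ ≤ M →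
        Var[fun U => WilsonRP.plaqRe r.ρ U
            ((Pi.single 0 0 : Site 4 (M + 1)), ⟨(0, 1), Fin.zero_lt_one⟩);
          wilsonMeasure (d := 4) (L := M + 1) r.ρ β] ≤ B / β ^ 2) :
    Theses.DirichletWindow.PlaquetteVarianceUpper := by
  intro G _ _ _ _ _ _ hG r
  obtain ⟨B, β₁, h⟩ := hT G hG r
  refine ⟨B, β₁, fun β hβ μ hμ => ?_⟩
  obtain ⟨M₀, hM⟩ := h β hβ
  have h0 : plaquetteCorrFn r.ρ μ (((0 : ℕ) : ℤ) • Pi.single (0 : Fin 4) (1 : ℤ)) ≤ B / β ^ 2 :=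
    plaquetteCorrFn_le_of_forall_torus r.ρ r.continuous hμ fun M hM' => by
      rw [← variance_tplaq_eq_cov r.ρ r.continuous β M]
      exact hM M hM'
  simpa using h0

/-- **`PolynomialWindow` may be verified on tori** (route `XiCompleteMonotonicity`'s crux 8937, a
door to `XiDiverges` by `xiDiverges_of_polynomialWindow`): if `A/(β² n⁸) ≤ Cov_{β,M+1}(P_0, P_{n e₀})`
for `β ≥ β₀`, `n₀ ≤ n ≤ β^p` and all tori with `M ≥ M₀(β, n)`, then `PolynomialWindow`. [folklore] -/
theorem polynomialWindow_of_torus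
    (hT : ∀ (G : Type) [Group G] [TopologicalSpace G] [IsTopologicalGroup G] [CompactSpace G]
      [MeasurableSpace G] [BorelSpace G], IsCompactSimpleLieGroup G → ∀ r : LatticeRep G,
      ∃ β₀ p A : ℝ, ∃ n₀ : ℕ, 0 < p ∧ 0 < A ∧ ∀ β : ℝ, β₀ ≤ β → ∀ n : ℕ, n₀ ≤ n →
        (n : ℝ) ≤ β ^ p → ∃ M₀ : ℕ, ∀ M : ℕ, M₀ ≤ M →
          A / (β ^ 2 * (n : ℝ) ^ 8) ≤
            cov[fun U => WilsonRP.plaqRe r.ρ U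
                ((Pi.single 0 0 : Site 4 (M + 1)), ⟨(0, 1), Fin.zero_lt_one⟩),
              fun U => WilsonRP.plaqRe r.ρ U
                ((Pi.single 0 ((n : ℕ) : ZMod (M + 1)) : Site 4 (M + 1)), ⟨(0, 1), Fin.zero_lt_one⟩);
              wilsonMeasure (d := 4) (L := M + 1) r.ρ β]) :
    Theses.XiCompleteMonotonicity.PolynomialWindow := by
  intro G _ _ _ _ _ _ hG r
  obtain ⟨β₀, p, A, n₀, hp, hA, h⟩ := hT G hG r
  refine ⟨β₀, p, A, n₀, hp, hA, fun β hβ μ hμ n hn hnp => ?_⟩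
  obtain ⟨M₀, hM⟩ := h β hβ n hn hnp
  exact le_plaquetteCorrFn_of_forall_torus r.ρ r.continuous hμ hM

/-- **The logarithmic window may be verified on tori.** If for every compact simple `G` and every
`r` there is `p` such that for every `C`, for all large `β`, SOME separation `n ≥ C log β` (chosen
from `β` alone) and some volume threshold `M₀` have `A/(β^p n^k) ≤ Cov_{β,M+1}(P_0, P_{n e₀})`
on every torus with `M ≥ M₀`, then every limit state obeys `A/(β^p n^k) ≤ f_μ(n e₀)` — the
hypothesis of `xiDiverges_of_logWindow`. [folklore] -/
theorem logWindow_of_torusLogWindow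
    (hT : ∀ (G : Type) [Group G] [TopologicalSpace G] [IsTopologicalGroup G] [CompactSpace G]
      [MeasurableSpace G] [BorelSpace G], IsCompactSimpleLieGroup G → ∀ r : LatticeRep G,
      ∃ p : ℕ, ∀ C : ℝ, ∃ A : ℝ, ∃ k : ℕ, ∃ β₁ : ℝ, 0 < A ∧ ∀ β : ℝ, β₁ ≤ β →
        ∃ n : ℕ, C * Real.log β ≤ n ∧ ∃ M₀ : ℕ, ∀ M : ℕ, M₀ ≤ M →
          A / (β ^ p * (n : ℝ) ^ k) ≤
            cov[fun U => WilsonRP.plaqRe r.ρ U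
                ((Pi.single 0 0 : Site 4 (M + 1)), ⟨(0, 1), Fin.zero_lt_one⟩),
              fun U => WilsonRP.plaqRe r.ρ U
                ((Pi.single 0 ((n : ℕ) : ZMod (M + 1)) : Site 4 (M + 1)), ⟨(0, 1), Fin.zero_lt_one⟩);
              wilsonMeasure (d := 4) (L := M + 1) r.ρ β]) :
    ∀ (G : Type) [Group G] [TopologicalSpace G] [IsTopologicalGroup G] [CompactSpace G]
      [MeasurableSpace G] [BorelSpace G], IsCompactSimpleLieGroup G → ∀ r : LatticeRep G,
      ∃ p : ℕ, ∀ C : ℝ, ∃ A : ℝ, ∃ k : ℕ, ∃ β₁ : ℝ, 0 < A ∧ ∀ β : ℝ, β₁ ≤ β →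
        ∀ μ ∈ infiniteVolumeLimitPoints (d := 4) r.ρ β, ∃ n : ℕ,
          C * Real.log β ≤ n ∧
          A / (β ^ p * (n : ℝ) ^ k) ≤
            plaquetteCorrFn r.ρ μ ((n : ℤ) • Pi.single (0 : Fin 4) (1 : ℤ)) := by
  intro G _ _ _ _ _ _ hG r
  obtain ⟨p, hp⟩ := hT G hG r
  refine ⟨p, fun C => ?_⟩
  obtain ⟨A, k, β₁, hA, h⟩ := hp C
  refine ⟨A, k, β₁, hA, fun β hβ μ hμ => ?_⟩
  obtain ⟨n, hCn, M₀, hM⟩ := h β hβ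
  exact ⟨n, hCn, le_plaquetteCorrFn_of_forall_torus r.ρ r.continuous hμ hM⟩

/-- **Torus logarithmic window ⇒ `XiDiverges`** (given the reflection-positivity half
`AxialLogConvexity`): `xiDiverges_of_logWindow` composed with `logWindow_of_torusLogWindow`.
[folklore] -/
theorem xiDiverges_of_torusLogWindow
    (hRP : Theses.DirichletWindow.AxialLogConvexity)
    (hT : ∀ (G : Type) [Group G] [TopologicalSpace G] [IsTopologicalGroup G] [CompactSpace G]
      [MeasurableSpace G] [BorelSpace G], IsCompactSimpleLieGroup G → ∀ r : LatticeRep G,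
      ∃ p : ℕ, ∀ C : ℝ, ∃ A : ℝ, ∃ k : ℕ, ∃ β₁ : ℝ, 0 < A ∧ ∀ β : ℝ, β₁ ≤ β →
        ∃ n : ℕ, C * Real.log β ≤ n ∧ ∃ M₀ : ℕ, ∀ M : ℕ, M₀ ≤ M →
          A / (β ^ p * (n : ℝ) ^ k) ≤
            cov[fun U => WilsonRP.plaqRe r.ρ U
                ((Pi.single 0 0 : Site 4 (M + 1)), ⟨(0, 1), Fin.zero_lt_one⟩),
              fun U => WilsonRP.plaqRe r.ρ U
                ((Pi.single 0 ((n : ℕ) : ZMod (M + 1)) : Site 4 (M + 1)), ⟨(0, 1), Fin.zero_lt_one⟩);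
              wilsonMeasure (d := 4) (L := M + 1) r.ρ β]) :
    Theses.DirichletWindow.XiDiverges :=
  xiDiverges_of_logWindow hRP (logWindow_of_torusLogWindow hT)

end Summit.QuantumFields.YangMills.Theorems

end
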